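import Summits.BirchSwinnertonDyer.BirchSwinnertonDyer.Theses.EisensteinDepletionAtTwo
import Summits.BirchSwinnertonDyer.Rank2.MatsunoAnalyticTwinSymbolParity
import HarnessLib

/-!
# Route `EisensteinDepletionAtTwo` (T-r3₂ door), support item stmt-BirchSwinnertonDyer-20245 `LevelFifteenSymbolParity`: PROOF

Cell `bsd-rank2` (HOME run/shared/lean/pub/bsd-rank2/), seat `bsd-rank2-eng` GEN 8. The route decl is BY NAME the `Rank2`
Prop `Summit.BirchSwinnertonDyer.Rank2.MatsunoAnalyticTwin.LevelFifteenSymbolParity`: for every newform `f` of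
`15A8 = [1,1,1,0,0]` (any level `N`), `[0]⁺_f = K/8` with `K` odd and `[a/2^m]⁺_f = [0]⁺_f + k/2`, `k ≡ m (mod 2)`, for odd `a`.
It is the tree theorem `Summit.BirchSwinnertonDyer.Rank2.LevelFifteen.levelFifteenSymbolParity_holds`
(`Rank2/MatsunoAnalyticTwinSymbolParity.lean` §4, with `Rank2/LevelFifteenManin{TablesDefs,Symbols,Descent}`,
`Rank2/LevelFifteenPeriods`): the level is `15` by Atkin–Lehner at squarefree conductor
(`IsNewformOf.level_eq_conductorNorm_of_squarefree`, no modularity input), the cusp lattice of `f` is `ℤE₁ ⊕ ℤE₂` by an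
explicit Manin-symbol presentation of `H₁(X₀(15), cusps; ℤ)` (24 symbols, kernel-decided 2- and 3-term relations), the
real period is `2|re E₁|`, and the Hecke relation at `2` (`a₂ = −1`) gives `[0]⁺ = ∓1/8`, `[1/2]⁺ = −3[0]⁺`.

THEOREMS ONLY (no definition, no named fact, no `sorry`). PARTITION: none — r_an ≥ 2, summit axis S0 (D-0036(1));
TWIN (D-0056): n/a. B1 honesty: a finite modular-symbol computation; nothing reads an analytic rank; no S0 motion.

References: B. Mazur, J. Tate, J. Teitelbaum, *Invent. Math.* 84 (1986) §I.8 [MazurTateTeitelbaum1986Invent];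
A. O. L. Atkin, J. Lehner, *Math. Ann.* 185 (1970) Thm. 3 [AtkinLehner1970]; J. E. Cremona, *Algorithms for Modular
Elliptic Curves* (1997) §2.2–2.8, Table 1 (15A) [CremonaAlgorithms1997].
-/

set_option linter.dupNamespace false

noncomputable section

namespace Summit.BirchSwinnertonDyer.BirchSwinnertonDyer.Theorems

/-- **Support `LevelFifteenSymbolParity` (item stmt-BirchSwinnertonDyer-20245 of route `EisensteinDepletionAtTwo`) HOLDS**,
unconditionally: the normalised plus modular symbols of any newform of `15A8` satisfy `[0]⁺ = K/8` (`K` odd) and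
`[a/2^m]⁺ − [0]⁺ = k/2` with `k ≡ m (mod 2)` for odd `a`.
[cite: MazurTateTeitelbaum1986Invent, §I.8] [cite: AtkinLehner1970, Thm. 3] [cite: CremonaAlgorithms1997, §2.8 and Table 1 (15A)] -/
theorem levelFifteenSymbolParity_proof :
    Summit.BirchSwinnertonDyer.BirchSwinnertonDyer.Theses.EisensteinDepletionAtTwo.LevelFifteenSymbolParity := by
  unfold Summit.BirchSwinnertonDyer.BirchSwinnertonDyer.Theses.EisensteinDepletionAtTwo.LevelFifteenSymbolParity
  exact Summit.BirchSwinnertonDyer.Rank2.LevelFifteen.levelFifteenSymbolParity_holds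

end Summit.BirchSwinnertonDyer.BirchSwinnertonDyer.Theorems

end
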